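import Literature.NumberTheory.LFunctions.MertensThirdUpperChain
import HarnessLib

/-!
# RH-FREE kernel certificate — «nothing here bears on the truth of RH»
# Rosser–Schoenfeld's (3.29) below `3 659 203`: certified run of the product upper chain, chunks 6–10
# (primes `974317 → 2063741`)

Topic: `Literature/NumberTheory/LFunctions`. Pure proof file (kernel computation; nothing is asserted, no definition).
Each `runK` evaluates `MertensThirdUpperChain.runD 15333` — `15333` steps along the prime table `ChainTable.table`,
each certifying the next prime `p'`, performing the comparison `cmp` behind (3.29)
`∏_{p ≤ x} p/(p−1) < e^γ log x (1 + 1/(2 log² x))` on `[p, p') ∩ [286, ∞)`, extending the enclosures of `log p'`,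
`log log p'`, and adding the upper enclosure of `log(p'/(p'−1))`. The four files `MertensThirdUpperChainRun1–4.lean`
(chunks 1–17, primes `3 → 3659203`) carry the certificate past Dusart's threshold `3 594 641`
(assembly: `MertensThirdUpperBound.lean`). The expected states were obtained by evaluating the same function compiled
(`#eval` on the Lean farm, 2026-08-28; all comparisons pass). `decide +kernel`, standard axioms only (`maxHeartbeats 0`).

## References
* J. B. Rosser, L. Schoenfeld, Illinois J. Math. 6 (1962), 64–94: Thm 8 (3.29), p. 70; §8 p. 87 (tables below 10⁸).
  [RosserSchoenfeld1962]
-/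

namespace Literature.NumberTheory.LFunctions.MertensThirdUpperChainRun

open MertensThirdUpperChain

set_option maxHeartbeats 0 in
/-- **Chunk 6 of the certified product upper run** (primes `974317` to `1187003`).
[cite: RosserSchoenfeld1962, Thm. 8 (3.29) and §8 p. 87] -/
theorem run6 :
    runD 15333
      ⟨974317, 16670472908117788623345073, 16670472908118264231339505,
        3172108739028779049147925, 3870003279524479884008533⟩ =
    some ⟨1187003, 16909175564208126273551012, 16909175564208601881927236,
        3189296450592738651757824, 3887210523464131208146065⟩ := by
  decide +kernel

set_option maxHeartbeats 0 in
/-- **Chunk 7 of the certified product upper run** (primes `1187003` to `1403239`).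
[cite: RosserSchoenfeld1962, Thm. 8 (3.29) and §8 p. 87] -/
theorem run7 :
    runD 15333
      ⟨1187003, 16909175564208126273551012, 16909175564208601881927236,
        3189296450592738651757824, 3887210523464131208146065⟩ =
    some ⟨1403239, 17111491104877457981529406, 17111491104877933590283172,
        3203675202055072481491292, 3901556957351922214814515⟩ := by
  decide +kernel

set_option maxHeartbeats 0 in
/-- **Chunk 8 of the certified product upper run** (primes `1403239` to `1621729`).
[cite: RosserSchoenfeld1962, Thm. 8 (3.29) and §8 p. 87] -/
theorem run8 :
    runD 15333
      ⟨1403239, 17111491104877457981529406, 17111491104877933590283172,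
        3203675202055072481491292, 3901556957351922214814515⟩ =
    some ⟨1621729, 17286434431633557415409340, 17286434431634033024532673,
        3215972183114260955873480, 3913836478918607654402813⟩ := by
  decide +kernel

set_option maxHeartbeats 0 in
/-- **Chunk 9 of the certified product upper run** (primes `1621729` to `1842329`).
[cite: RosserSchoenfeld1962, Thm. 8 (3.29) and §8 p. 87] -/
theorem run9 :
    runD 15333
      ⟨1621729, 17286434431633557415409340, 17286434431634033024532673,
        3215972183114260955873480, 3913836478918607654402813⟩ =
    some ⟨1842329, 17440618011498367853563031, 17440618011498843463051306,
        3226707198816513289586724, 3924554518946054528655333⟩ := by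
  decide +kernel

set_option maxHeartbeats 0 in
/-- **Chunk 10 of the certified product upper run** (primes `1842329` to `2063741`).
[cite: RosserSchoenfeld1962, Thm. 8 (3.29) and §8 p. 87] -/
theorem run10 :
    runD 15333
      ⟨1842329, 17440618011498367853563031, 17440618011498843463051306,
        3226707198816513289586724, 3924554518946054528655333⟩ =
    some ⟨2063741, 17577818788978594365443835, 17577818788979069975295767,
        3236180288846491774256043, 3934057689504062723072588⟩ := by
  decide +kernel

end Literature.NumberTheory.LFunctions.MertensThirdUpperChainRun
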